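/-
Copyright (c) 2026. All rights reserved.
Released under Apache 2.0 license as described in the file LICENSE.
Authors: abc-iut cell, prover seat abc-iut-w5-d241 (wave 5, gen 9); threshold number first posted by
abc-iut-w5-d030 (gen 8).
-/
import Literature.IUT.LogVolume.PilotDivisors
import Literature.IUT.LogThetaLattice.PacketLogVolumes
import Mathlib.Analysis.SpecialFunctions.Trigonometric.Basic
import Mathlib.Tactic.FieldSimp
import Mathlib.Tactic.Ring
import Mathlib.Tactic.Linarith
import Mathlib.Tactic.Positivity
import HarnessLib

/-!
# The archimedean threshold for the pilot-degree comparison `−deĝ̲(P_q) ≤ −deĝ̲_lgp(P_Θ) + 𝔼_j (j+1)·c`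

Proof-only companion (theorems, no definitions) of `PilotDivisors.lean` (abc-iut-c312-3: Dupuy–Hilado,
*The statement of Mochizuki's Corollary 3.12*, arXiv:2004.13228 = Ramanujan J. **68** (2025), Def. 3.1.1
and §3.3 — the `q`-pilot divisor `P_q`, the theta-pilot lgp-divisor `P_Θ = (j²·P_q)_{j=1}^{ℓ⋇}`, and the
closed form `deĝ_lgp(P_Θ) − deĝ(P_q) = ((l+1)/24 − 1/(2l))·deĝ(𝔮)`, `degLgp_thetaPilot_sub_deg_qPilot`)
and of the procession normalisation `processionNormalized vol = (Σ_j vol_j)/ℓ⋇` of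
`LogThetaLattice/PacketLogVolumes.lean` ([IUTchIII] Prop. 3.9 (i): the average over the capsules
`S^±_{j+1}`, `j = 1, …, ℓ⋇`).

## What is proved (everything; no named fact)

For pilot data `X = (F, j_E, S, l)` (`l ≥ 5`) and any real constant `c` (in the cell's application
`c = log π`, the archimedean constant of the honest-`∞` container MODEL of abc-iut-w5-d163, whose
capsule with index set `S^±_{j+1} = {0, …, j}` contributes `|S^±_{j+1}|·c = (j+1)·c`; with the tree's
indexing `i : Fin ℓ⋇ ↔ j = i+1` this is `(i+2)·c`):

* `processionNormalized_natCast_add_two_mul` — `𝔼_j (j+1)·c := (1/ℓ⋇)·Σ_{i<ℓ⋇} (i+2)·c = ((l+5)/4)·c`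
  (as `ℓ⋇ = (l−1)/2`);
* `ndegLgp_thetaPilot_sub_ndeg_qPilot` — the normalised gap
  `deĝ̲_lgp(P_Θ) − deĝ̲(P_q) = ((l+4)(l−3)/(24l))·deĝ̲(𝔮)` (the tree's closed form divided by `[F:ℚ]`;
  `(l+1)/24 − 1/(2l) = (l+4)(l−3)/(24l)`);
* **`neg_ndeg_qPilot_le_iff`** — the comparison
  `−deĝ̲(P_q) ≤ −deĝ̲_lgp(P_Θ) + 𝔼_j (j+1)·c` holds **iff** `deĝ̲(𝔮) ≤ 6·l·(l+5)·c/((l+4)(l−3))`,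
  where `𝔮 = Σ_{v∈S} ord_v(q_v)[v]` is the divisor of the Tate parameters (`PilotData.qDivisor`) and
  `deĝ̲ = deĝ/[F:ℚ]`; the same with `c = log π` (`neg_ndeg_qPilot_le_iff_log_pi`);
* (private `threshold_le` / `six_le_threshold`, public `threshold_mul_le` / `six_mul_le_threshold_mul`) the envelope `6·l·(l+5)/((l+4)(l−3)) ≤ 50/3` for every real `l ≥ 5` (the left side
  is decreasing in `l`, equal to `50/3` at `l = 5`, with limit `6`), whence
  `not_neg_ndeg_qPilot_le_of_lt` — for `c ≥ 0` the comparison FAILS as soon as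
  `deĝ̲(𝔮) > (50/3)·c` (for `c = log π`: `(50/3)·log π < 19.1`), and `neg_ndeg_qPilot_le_of_le` — it
  HOLDS whenever `deĝ̲(𝔮) ≤ 6·c` (`6 ≤ 6·l·(l+5)/((l+4)(l−3))`).

So the comparison is true exactly on a family of pilot data of BOUNDED normalised Tate-divisor degree
(a height-type bound, uniform in `F` and in `l`), and false off it.

Consumer (by name): the fourth-corner certificate of abc-iut-c312-7,
`Summit.ABC.IUTFork.Thm311.Real.globalVolumeTransport_settingPrVolArchSharp_iff` (Team B's region-volume
input `GlobalVolumeTransport` at the print-normalised setting with honest archimedean container is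
equivalent to `−deĝ̲(P_q) ≤ −deĝ̲_lgp(P_Θ) + processionNormalized (i ↦ |S^±_{i+2}|·log π)`), whose
right-hand side is the left-hand side of `neg_ndeg_qPilot_le_iff_log_pi` after
`Fintype.card (S^±_{i+2}) = i+2`; the cell's residual list C312-RESIDUALS §0 recorded the sign of that
real number as "not evaluated in the tree" — this file evaluates it.  Classical real arithmetic on
Arakelov degrees; nothing here is disputed mathematics, no IUT statement is asserted, the `∞`-container
is a MODEL of another seat, and nothing bears on the truth of [IUTchIII] Cor. 3.12.

## References

* T. Dupuy, A. Hilado, *The statement of Mochizuki's Corollary 3.12, initial theta data, and the first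
  two indeterminacies*, Ramanujan J. **68** (2025), Def. 3.1.1, §3.3 [DupuyHilado2025].
* S. Mochizuki, *Inter-universal Teichmüller theory III*, PRIMS **57** (2021), Prop. 3.9 (i)
  (procession normalisation) [Mochizuki2012, claim key of the series, status disputed (D-0012)].
-/

noncomputable section

namespace Literature.IUT.LogVolume

namespace PilotData

open Finset Literature.IUT.LogThetaLattice

variable {F : Type*} [Field F] [NumberField F] (X : PilotData F)

/-! ### §1. The procession-normalised archimedean constant `𝔼_j (j+1)·c = ((l+5)/4)·c` -/

/-- Plumbing: `Σ_{i<n} (i+2) = n(n+3)/2` over `ℝ`. [folklore] -/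
private theorem sum_natCast_add_two (n : ℕ) :
    ∑ i ∈ range n, (((i : ℕ) : ℝ) + 2) = (n : ℝ) * (n + 3) / 2 := by
  induction n with
  | zero => simp
  | succ n ih =>
    rw [Finset.sum_range_succ, ih]
    push_cast
    ring

/-- `ℓ⋇ ≠ 0` as a real number (`ℓ⋇ ≥ 2`). [cite: DupuyHilado2025, §3.3] -/
theorem lstar_cast_ne_zero : (X.lstar : ℝ) ≠ 0 := by
  have := X.two_le_lstar
  exact_mod_cast (by omega : X.lstar ≠ 0)

/-- **`𝔼_j (j+1)·c = ((l+5)/4)·c`**: the procession-normalised average over `j = 1, …, ℓ⋇` of the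
constants `|S^±_{j+1}|·c = (j+1)·c` — indexed by `i : Fin ℓ⋇`, `j = i+1`, so the `i`-th term is `(i+2)·c` —
equals `((ℓ⋇+3)/2)·c = ((l+5)/4)·c` since `l = 2ℓ⋇+1`.
[cite: Mochizuki2012, IUTchIII Prop. 3.9 (i) p. 116] [cite: DupuyHilado2025, §3.3] -/
theorem processionNormalized_natCast_add_two_mul (c : ℝ) :
    processionNormalized (fun i : Fin X.lstar => (((i : ℕ) : ℝ) + 2) * c) =
      ((X.l : ℝ) + 5) / 4 * c := by
  have hn := X.lstar_cast_ne_zero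
  simp only [processionNormalized, ← Finset.sum_mul]
  rw [Fin.sum_univ_eq_sum_range (fun i => ((i : ℝ) + 2)) X.lstar, sum_natCast_add_two, X.l_cast]
  field_simp
  ring

/-- The same average with the summand written as the cast of the natural number `i+2`
(the form `(Fintype.card (Fin (i+2)) : ℝ) * c` in which a capsule cardinality arrives).
[cite: Mochizuki2012, IUTchIII Prop. 3.9 (i) p. 116] [cite: DupuyHilado2025, §3.3] -/
theorem processionNormalized_cast_add_two_mul (c : ℝ) :
    processionNormalized (fun i : Fin X.lstar => (((i : ℕ) + 2 : ℕ) : ℝ) * c) =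
      ((X.l : ℝ) + 5) / 4 * c := by
  rw [← X.processionNormalized_natCast_add_two_mul c]
  congr 1
  funext i
  push_cast
  ring

/-! ### §2. The normalised gap and the threshold -/

/-- `(l+4)(l−3) > 0` for the prime `l ≥ 5` of the pilot data. [cite: DupuyHilado2025, §3.3] -/
theorem lFactor_pos : (0 : ℝ) < ((X.l : ℝ) + 4) * ((X.l : ℝ) - 3) := by
  have h5 : (5 : ℝ) ≤ X.l := by exact_mod_cast X.five_le_l
  have h1 : (0 : ℝ) < (X.l : ℝ) + 4 := by linarith
  have h2 : (0 : ℝ) < (X.l : ℝ) - 3 := by linarith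
  positivity

/-- `l > 0` as a real number. [cite: DupuyHilado2025, §3.3] -/
theorem l_cast_pos : (0 : ℝ) < X.l := by
  have h5 : (5 : ℝ) ≤ X.l := by exact_mod_cast X.five_le_l
  linarith

/-- **The normalised gap** `deĝ̲_lgp(P_Θ) − deĝ̲(P_q) = ((l+4)(l−3)/(24l))·deĝ̲(𝔮)` — the closed form
`degLgp_thetaPilot_sub_deg_qPilot` divided by `[F:ℚ]`, with `(l+1)/24 − 1/(2l) = (l+4)(l−3)/(24l)`.
[cite: DupuyHilado2025, Def. 3.1.1, §3.3, §2.5.4] -/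
theorem ndegLgp_thetaPilot_sub_ndeg_qPilot :
    LgpDivisor.ndegLgp X.thetaPilot - FinDivisor.ndeg F X.qPilot =
      ((X.l : ℝ) + 4) * ((X.l : ℝ) - 3) / (24 * X.l) * FinDivisor.ndeg F X.qDivisor := by
  have hd : (0 : ℝ) < Module.finrank ℚ F := FinDivisor.finrank_pos
  have hl := X.l_cast_pos
  rw [LgpDivisor.ndegLgp_eq, FinDivisor.ndeg_apply, FinDivisor.ndeg_apply, ← sub_div,
    degLgp_thetaPilot_sub_deg_qPilot]
  field_simp
  ring

/-- **THE THRESHOLD.** For any real constant `c`, the archimedean-corrected pilot-degree comparison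
`−deĝ̲(P_q) ≤ −deĝ̲_lgp(P_Θ) + 𝔼_j (j+1)·c` holds iff the normalised degree of the Tate divisor
`𝔮 = Σ_{v∈S} ord_v(q_v)[v]` satisfies `deĝ̲(𝔮) ≤ 6·l·(l+5)·c/((l+4)(l−3))`.
[cite: DupuyHilado2025, Def. 3.1.1, §3.3] [cite: Mochizuki2012, IUTchIII Prop. 3.9 (i) p. 116] -/
theorem neg_ndeg_qPilot_le_iff (c : ℝ) :
    -FinDivisor.ndeg F X.qPilot ≤ -LgpDivisor.ndegLgp X.thetaPilot +
        processionNormalized (fun i : Fin X.lstar => (((i : ℕ) : ℝ) + 2) * c) ↔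
      FinDivisor.ndeg F X.qDivisor ≤ 6 * X.l * ((X.l : ℝ) + 5) * c / (((X.l : ℝ) + 4) * ((X.l : ℝ) - 3)) := by
  rw [X.processionNormalized_natCast_add_two_mul c, le_div_iff₀ X.lFactor_pos]
  have hgap := X.ndegLgp_thetaPilot_sub_ndeg_qPilot
  have hl := X.l_cast_pos
  have hL := X.lFactor_pos
  have key : LgpDivisor.ndegLgp X.thetaPilot - FinDivisor.ndeg F X.qPilot ≤ ((X.l : ℝ) + 5) / 4 * c ↔
      FinDivisor.ndeg F X.qDivisor * (((X.l : ℝ) + 4) * ((X.l : ℝ) - 3)) ≤ 6 * X.l * ((X.l : ℝ) + 5) * c := by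
    rw [hgap]
    constructor
    · intro h
      have h' := mul_le_mul_of_nonneg_left h (by positivity : (0 : ℝ) ≤ 24 * X.l)
      have e1 : 24 * (X.l : ℝ) * (((X.l : ℝ) + 4) * ((X.l : ℝ) - 3) / (24 * X.l) * FinDivisor.ndeg F X.qDivisor) =
          FinDivisor.ndeg F X.qDivisor * (((X.l : ℝ) + 4) * ((X.l : ℝ) - 3)) := by
        field_simp
      have e2 : 24 * (X.l : ℝ) * (((X.l : ℝ) + 5) / 4 * c) = 6 * X.l * ((X.l : ℝ) + 5) * c := by ring
      rwa [e1, e2] at h'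
    · intro h
      have h' := mul_le_mul_of_nonneg_left h (by positivity : (0 : ℝ) ≤ 1 / (24 * X.l))
      have e1 : 1 / (24 * (X.l : ℝ)) * (FinDivisor.ndeg F X.qDivisor * (((X.l : ℝ) + 4) * ((X.l : ℝ) - 3))) =
          ((X.l : ℝ) + 4) * ((X.l : ℝ) - 3) / (24 * X.l) * FinDivisor.ndeg F X.qDivisor := by
        field_simp
      have e2 : 1 / (24 * (X.l : ℝ)) * (6 * X.l * ((X.l : ℝ) + 5) * c) = ((X.l : ℝ) + 5) / 4 * c := by
        field_simp
        ring
      rwa [e1, e2] at h'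
  constructor
  · intro h
    exact key.mp (by linarith)
  · intro h
    have := key.mpr h
    linarith

/-- The threshold with the summand in capsule-cardinality form `((i+2 : ℕ) : ℝ)·c`.
[cite: DupuyHilado2025, Def. 3.1.1, §3.3] [cite: Mochizuki2012, IUTchIII Prop. 3.9 (i) p. 116] -/
theorem neg_ndeg_qPilot_le_iff_cast (c : ℝ) :
    -FinDivisor.ndeg F X.qPilot ≤ -LgpDivisor.ndegLgp X.thetaPilot +
        processionNormalized (fun i : Fin X.lstar => (((i : ℕ) + 2 : ℕ) : ℝ) * c) ↔
      FinDivisor.ndeg F X.qDivisor ≤ 6 * X.l * ((X.l : ℝ) + 5) * c / (((X.l : ℝ) + 4) * ((X.l : ℝ) - 3)) := by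
  rw [← X.neg_ndeg_qPilot_le_iff c, X.processionNormalized_cast_add_two_mul,
    X.processionNormalized_natCast_add_two_mul]

/-- **The threshold at the archimedean constant `c = log π`** (the honest-`∞` container's per-capsule
constant): `−deĝ̲(P_q) ≤ −deĝ̲_lgp(P_Θ) + 𝔼_j (j+1)·log π ↔ deĝ̲(𝔮) ≤ 6·l·(l+5)·log π/((l+4)(l−3))`
(`≈ 19.08` at `l = 5`, `≈ 13.11` at `l = 7`, `≈ 10.07` at `l = 11`, `↘ 6·log π ≈ 6.87`).
[cite: DupuyHilado2025, Def. 3.1.1, §3.3] [cite: Mochizuki2012, IUTchIII Prop. 3.9 (i) p. 116] -/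
theorem neg_ndeg_qPilot_le_iff_log_pi :
    -FinDivisor.ndeg F X.qPilot ≤ -LgpDivisor.ndegLgp X.thetaPilot +
        processionNormalized (fun i : Fin X.lstar => (((i : ℕ) + 2 : ℕ) : ℝ) * Real.log Real.pi) ↔
      FinDivisor.ndeg F X.qDivisor ≤
        6 * X.l * ((X.l : ℝ) + 5) * Real.log Real.pi / (((X.l : ℝ) + 4) * ((X.l : ℝ) - 3)) :=
  X.neg_ndeg_qPilot_le_iff_cast (Real.log Real.pi)

/-! ### §3. The numeric envelope `6 ≤ 6·l·(l+5)/((l+4)(l−3)) ≤ 50/3` and its two consequences -/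

/-- **Envelope (upper):** `6·l·(l+5)/((l+4)(l−3)) ≤ 50/3` for every real `l ≥ 5` — equivalently
`18·l·(l+5) ≤ 50·(l+4)(l−3)`, i.e. `0 ≤ 8·(l−5)(4l+15)`; equality at `l = 5`. [folklore] -/
private theorem threshold_le {l : ℝ} (hl : 5 ≤ l) : 6 * l * (l + 5) / ((l + 4) * (l - 3)) ≤ 50 / 3 := by
  have hL : 0 < (l + 4) * (l - 3) := by
    have h1 : 0 < l + 4 := by linarith
    have h2 : 0 < l - 3 := by linarith
    positivity
  rw [div_le_div_iff₀ hL (by norm_num : (0 : ℝ) < 3)]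
  nlinarith [mul_nonneg (sub_nonneg.mpr hl) (by linarith : (0 : ℝ) ≤ 4 * l + 15)]

/-- **Envelope (lower):** `6 ≤ 6·l·(l+5)/((l+4)(l−3))` for every real `l ≥ 5` — equivalently
`(l+4)(l−3) ≤ l(l+5)`, i.e. `−12 ≤ 4l`. [folklore] -/
private theorem six_le_threshold {l : ℝ} (hl : 5 ≤ l) : 6 ≤ 6 * l * (l + 5) / ((l + 4) * (l - 3)) := by
  have hL : 0 < (l + 4) * (l - 3) := by
    have h1 : 0 < l + 4 := by linarith
    have h2 : 0 < l - 3 := by linarith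
    positivity
  rw [le_div_iff₀ hL]
  nlinarith

/-- The envelope at the pilot data's prime `l`: `6·l·(l+5)·c/((l+4)(l−3)) ≤ (50/3)·c` for `c ≥ 0`.
[cite: DupuyHilado2025, §3.3] -/
theorem threshold_mul_le {c : ℝ} (hc : 0 ≤ c) :
    6 * X.l * ((X.l : ℝ) + 5) * c / (((X.l : ℝ) + 4) * ((X.l : ℝ) - 3)) ≤ 50 / 3 * c := by
  have h5 : (5 : ℝ) ≤ X.l := by exact_mod_cast X.five_le_l
  have h := mul_le_mul_of_nonneg_right (threshold_le h5) hc
  calc 6 * X.l * ((X.l : ℝ) + 5) * c / (((X.l : ℝ) + 4) * ((X.l : ℝ) - 3))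
        = 6 * X.l * ((X.l : ℝ) + 5) / (((X.l : ℝ) + 4) * ((X.l : ℝ) - 3)) * c := by ring
    _ ≤ 50 / 3 * c := h

/-- The envelope at the pilot data's prime `l`, lower side: `6·c ≤ 6·l·(l+5)·c/((l+4)(l−3))` for `c ≥ 0`.
[cite: DupuyHilado2025, §3.3] -/
theorem six_mul_le_threshold_mul {c : ℝ} (hc : 0 ≤ c) :
    6 * c ≤ 6 * X.l * ((X.l : ℝ) + 5) * c / (((X.l : ℝ) + 4) * ((X.l : ℝ) - 3)) := by
  have h5 : (5 : ℝ) ≤ X.l := by exact_mod_cast X.five_le_l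
  have h := mul_le_mul_of_nonneg_right (six_le_threshold h5) hc
  calc 6 * c ≤ 6 * X.l * ((X.l : ℝ) + 5) / (((X.l : ℝ) + 4) * ((X.l : ℝ) - 3)) * c := h
    _ = 6 * X.l * ((X.l : ℝ) + 5) * c / (((X.l : ℝ) + 4) * ((X.l : ℝ) - 3)) := by ring

/-- **Failure above the envelope.** If `c ≥ 0` and the normalised Tate-divisor degree exceeds
`(50/3)·c`, the archimedean-corrected comparison `−deĝ̲(P_q) ≤ −deĝ̲_lgp(P_Θ) + 𝔼_j (j+1)·c` FAILS —
for every admissible prime `l ≥ 5` of the pilot data. [cite: DupuyHilado2025, Def. 3.1.1, §3.3] -/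
theorem not_neg_ndeg_qPilot_le_of_lt {c : ℝ} (hc : 0 ≤ c)
    (hbig : 50 / 3 * c < FinDivisor.ndeg F X.qDivisor) :
    ¬ (-FinDivisor.ndeg F X.qPilot ≤ -LgpDivisor.ndegLgp X.thetaPilot +
        processionNormalized (fun i : Fin X.lstar => (((i : ℕ) : ℝ) + 2) * c)) := by
  rw [X.neg_ndeg_qPilot_le_iff c]
  have := X.threshold_mul_le hc
  intro h
  linarith

/-- **Validity below the envelope.** If `c ≥ 0` and `deĝ̲(𝔮) ≤ 6·c`, the archimedean-corrected
comparison HOLDS — for every admissible prime `l ≥ 5`. [cite: DupuyHilado2025, Def. 3.1.1, §3.3] -/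
theorem neg_ndeg_qPilot_le_of_le {c : ℝ} (hc : 0 ≤ c)
    (hsmall : FinDivisor.ndeg F X.qDivisor ≤ 6 * c) :
    -FinDivisor.ndeg F X.qPilot ≤ -LgpDivisor.ndegLgp X.thetaPilot +
        processionNormalized (fun i : Fin X.lstar => (((i : ℕ) : ℝ) + 2) * c) := by
  rw [X.neg_ndeg_qPilot_le_iff c]
  exact hsmall.trans (X.six_mul_le_threshold_mul hc)

/-- The capsule-cardinality form of the failure statement at `c = log π`: if
`deĝ̲(𝔮) > (50/3)·log π` then `−deĝ̲(P_q) ≤ −deĝ̲_lgp(P_Θ) + 𝔼_j (j+1)·log π` is false.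
[cite: DupuyHilado2025, Def. 3.1.1, §3.3] [cite: Mochizuki2012, IUTchIII Prop. 3.9 (i) p. 116] -/
theorem not_neg_ndeg_qPilot_le_log_pi_of_lt
    (hbig : 50 / 3 * Real.log Real.pi < FinDivisor.ndeg F X.qDivisor) :
    ¬ (-FinDivisor.ndeg F X.qPilot ≤ -LgpDivisor.ndegLgp X.thetaPilot +
        processionNormalized (fun i : Fin X.lstar => (((i : ℕ) + 2 : ℕ) : ℝ) * Real.log Real.pi)) := by
  have hc : 0 ≤ Real.log Real.pi := Real.log_nonneg (by linarith [Real.two_le_pi])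
  rw [X.processionNormalized_cast_add_two_mul, ← X.processionNormalized_natCast_add_two_mul]
  exact X.not_neg_ndeg_qPilot_le_of_lt hc hbig

/-- The capsule-cardinality form of the validity statement at `c = log π`: if `deĝ̲(𝔮) ≤ 6·log π` then
`−deĝ̲(P_q) ≤ −deĝ̲_lgp(P_Θ) + 𝔼_j (j+1)·log π` holds.
[cite: DupuyHilado2025, Def. 3.1.1, §3.3] [cite: Mochizuki2012, IUTchIII Prop. 3.9 (i) p. 116] -/
theorem neg_ndeg_qPilot_le_log_pi_of_le
    (hsmall : FinDivisor.ndeg F X.qDivisor ≤ 6 * Real.log Real.pi) :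
    -FinDivisor.ndeg F X.qPilot ≤ -LgpDivisor.ndegLgp X.thetaPilot +
        processionNormalized (fun i : Fin X.lstar => (((i : ℕ) + 2 : ℕ) : ℝ) * Real.log Real.pi) := by
  have hc : 0 ≤ Real.log Real.pi := Real.log_nonneg (by linarith [Real.two_le_pi])
  rw [X.processionNormalized_cast_add_two_mul, ← X.processionNormalized_natCast_add_two_mul]
  exact X.neg_ndeg_qPilot_le_of_le hc hsmall

end PilotData

end Literature.IUT.LogVolume

end
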